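import Summits.AtomisticToContinuum.BoseEinsteinCondensation.Theses.BECNewtonPolicyIteration
import Literature.MathematicalPhysics.QuantumManyBody.CondensateOccupationStability

/-!
# Route `BECNewtonPolicyIteration` — support item `OccupationStabilityPeriodic` (stmt-AtomisticToContinuum-8960)

Closes the support item stmt-AtomisticToContinuum-8960 (exact signature of
`Summit.AtomisticToContinuum.BoseEinsteinCondensation.Theses.BECNewtonPolicyIteration.OccupationStabilityPeriodic`):
for periodic trial states `Ψ, Φ ∈ PeriodicTrialState N L` and a unit complex number `c`,

  `n₀(Ψ)^{1/2} ≤ n₀(Φ)^{1/2} + N^{1/2} (∫_{Λ^N} |Ψ - cΦ|²)^{1/2}`,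

where `n₀ = condensateOccupation N L` is the expected occupation of the constant mode on the cell
`Λ^N = [0,L)^{3N}` [LSSY2005, §1.2 (1.17); Fournais2020, (1.3)–(1.5)].

Proof (bookkeeping over `Literature/…/CondensateOccupationStability.lean`, the torus twin of
`BECFisherTransferPeriodicOccupationStability.lean` without the side-length hypothesis): `√n₀ = ‖a₀ ·‖`
is a seminorm (`condensateOccupation_rpow_half_le_add`, Minkowski in `L²(Λ^{N-1})`), it is phase
invariant (`condensateOccupation_const_mul_of_norm_eq_one`), and `a₀` is bounded by `√N`
(`condensateOccupation_le_card_mul_lintegral`, the `k = 0` term of Parseval), so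
`√n₀(Ψ) ≤ √n₀(cΦ) + √n₀(Ψ - cΦ) = √n₀(Φ) + √n₀(Ψ - cΦ) ≤ √n₀(Φ) + √N ‖Ψ - cΦ‖₂`.
The statement carries no `0 < L`: for `N = 0` every occupation vanishes, and for `N ≥ 1` a trial
state forces `0 < L` (nothing is normalised on the empty cell `[0,L)^{3N}`, `L ≤ 0`).
-/

noncomputable section

namespace Summit.AtomisticToContinuum.BoseEinsteinCondensation.Theorems

open MeasureTheory
open scoped ENNReal NNReal
open Literature.MathematicalPhysics.QuantumManyBody.BoseGas

/-- A periodic trial state with at least one particle lives on a torus of positive side: its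
normalisation `∫_{[0,L)^{3N}} |Ψ|² = 1` is impossible on the empty cell (`L ≤ 0`). [folklore] -/
theorem occupationStabilityPeriodic_side_pos {n : ℕ} {L : ℝ} (Ψ : PeriodicTrialState (n + 1) L) :
    0 < L := by
  by_contra h
  have hcell : cellN (n + 1) L = ∅ := by
    refine Set.eq_empty_iff_forall_notMem.2 fun X hX => ?_
    have h0 := hX 0 0
    rw [Set.mem_Ico] at h0
    exact h (h0.1.trans_lt h0.2)
  have h1 := Ψ.norm_eq
  rw [hcell, Measure.restrict_empty, lintegral_zero_measure] at h1
  exact zero_ne_one h1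

/-- **`OccupationStabilityPeriodic`** (closes stmt-AtomisticToContinuum-8960, exact route signature):
for periodic trial states `Ψ, Φ` of `N` bosons on the torus of side `L` and `|c| = 1`,
`n₀(Ψ)^{1/2} ≤ n₀(Φ)^{1/2} + N^{1/2} (∫_{Λ^N}|Ψ - cΦ|²)^{1/2}` — `√n₀` is a phase-invariant seminorm
dominated by `√N ‖·‖_{L²(Λ^N)}`. [cite: LSSY2005, §1.2 (1.17), App. A (A.11), (A.13)] -/
theorem occupationStabilityPeriodic_proof :
    Summit.AtomisticToContinuum.BoseEinsteinCondensation.Theses.BECNewtonPolicyIteration.OccupationStabilityPeriodic := by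
  intro N L Ψ Φ c hc
  cases N with
  | zero => simp [condensateOccupation, occupation]
  | succ n =>
    have hL : 0 < L := occupationStabilityPeriodic_side_pos Ψ
    have hΨc : Continuous Ψ.ψ := Ψ.contDiff.continuous
    have hcΦc : Continuous fun X => c * Φ.ψ X := continuous_const.mul Φ.contDiff.continuous
    -- Minkowski: `√n₀(Ψ) ≤ √n₀(cΦ) + √n₀(Ψ - cΦ)`, and phase invariance `n₀(cΦ) = n₀(Φ)`
    have hmink := condensateOccupation_rpow_half_le_add L hΨc hcΦc
    rw [condensateOccupation_const_mul_of_norm_eq_one (n + 1) L hc] at hmink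
    refine hmink.trans ?_
    gcongr
    -- `‖a₀‖ ≤ √N`: `n₀(Ψ - cΦ) ≤ N ∫_{Λ^N} |Ψ - cΦ|²`
    rw [← ENNReal.mul_rpow_of_nonneg _ _ (by norm_num : (0 : ℝ) ≤ 1 / 2)]
    exact ENNReal.rpow_le_rpow (condensateOccupation_le_card_mul_lintegral hL (hΨc.sub hcΦc))
      (by norm_num)

end Summit.AtomisticToContinuum.BoseEinsteinCondensation.Theorems
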